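import Summits.NavierStokesRegularity.NavierStokesRegularity.Theorems.RellichScarSymmetricScarExistsApexClassicalRepresentative
import Literature.Analysis.FluidPDE.PineauVicolRSSHolds
import Literature.Analysis.FluidPDE.AxisymmetricVorticityTransport
import HarnessLib

/-!
# Route CorkscrewDynamo · crux `CorkscrewProfile` (stmt-NavierStokesRegularity-11282) — the Pineau–Vicol speed
# window of a rotated self-similar Oseen-gauge field (lead c4, line `registered`, tool stub F6 `stub_rssWindow`)

Registered tool stub `stub_rssWindow`: Pineau–Vicol 2026, Theorem 1.4 (the RSS Liouville theorem for small and
large angular speeds, tree fact `pineauVicol2026_rss_liouville_holds`) transported to the OSEEN (KNSS) GAUGE in which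
the near-identity rigidity theorem `exists_rss_of_nearIdentity` produces its limit: a Type-I ancient mild field `W`
(`IsTypeIAncientMild C₀ W`, `HasTypeIDecay C₀ W`) which is ROTATED SELF-SIMILAR about `e₃` with angle rate `β`,
`IsRotatedDSS μ (rotZLIE (β log μ)) W` for every `μ > 0`, i.e. `μ R_{−β log μ} W(μ²t, μ R_{β log μ} x) = W(t, x)`.

* `rss_eq_pvAnsatz` — THE DICTIONARY: such a field is Pineau–Vicol's ansatz (1.7) of its own `t = −1` slice with
  speed `α = −β/2`: for `t < 0`, `W(t, x) = pvAnsatz (−β/2) (W(−1)) t x`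
  (`= (−t)^{−1/2} R(αs) W(−1, R(−αs) x/√(−t))`, `s = −log(−t)`); proof: the RSS law at `μ = (−t)^{−1/2}`.
* `rss_eq_zero_of_slice` — hence `W(−1) = 0` forces `W ≡ 0` on the whole past.
* `stub_rssWindow` (registered signature, verbatim) — for every `C₀ > 0` there are `0 < α₁, α₂` (Pineau–Vicol's
  `α_(C₀)`, `ᾱ(C₀)`) such that every such field with `W(−1) ≠ 0` has `α₁ ≤ |β|/2 ≤ α₂`: `W` is classical on
  `(−∞, 0)` for one smooth pressure (`exists_isClassicalNSSolutionOn_Iio_of_isTypeIAncientMild`), hence on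
  `[−1, 0)`; the slice `W(−1)` is `C^∞ ⊇ C²`; Theorem 1.4 kills the profile when `|β|/2 < α₁` or `α₂ < |β|/2`.
* `rss_speed_mem_window` — the same with nontriviality at ANY negative time (`∃ t < 0, ∃ x, W t x ≠ 0`), and
  `rss_angleRate_ne_zero` — in particular `β ≠ 0` (no appeal to Chae–Wolf 2017 / Tsai 1998 needed at this level:
  it is the small-speed half of Theorem 1.4).

References: B. Pineau, V. Vicol, *On rotated backwards self-similar solutions of the incompressible 3D Navier–Stokes
equations*, arXiv:2607.09619 (2026), (1.7) p. 3, Remark 1.3, Theorem 1.4 p. 4 [PineauVicol2026]; D. Chae, J. Wolf,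
Comm. PDE 42 (2017) = arXiv:1610.09464, Def. 1.1 [ChaeWolf2017RemovingDSS].
-/

noncomputable section

open Set Function Literature.Analysis.FluidPDE

namespace Summit.NavierStokesRegularity.NavierStokesRegularity.Theorems.CorkscrewProfile.Birth

set_option linter.dupNamespace false

open Summit.NavierStokesRegularity.NavierStokesRegularity.Theorems.SymmetricScarExists.LogtimeBernoulli
  (exists_isClassicalNSSolutionOn_Iio_of_isTypeIAncientMild)

/-! ### The dictionary: RSS about `e₃` in the Oseen gauge is Pineau–Vicol's ansatz -/

/-- **An Oseen-gauge field which is rotated self-similar about `e₃` with angle rate `β` is Pineau–Vicol's ansatz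
(1.7) of its own `t = −1` slice, with angular speed `α = −β/2`.** If `μ R_{−β log μ} W(μ²t, μ R_{β log μ} x) = W(t, x)`
for every `μ > 0` (`IsRotatedDSS μ (rotZLIE (β log μ)) W`), then for `t < 0`
`W(t, x) = (−t)^{−1/2} R(αs) W(−1, R(−αs) x/√(−t))`, `s = −log(−t)`, `α = −β/2`: take `μ = (−t)^{−1/2}`, so that
`μ²t = −1` and `β log μ = −(β/2) log(−t) = −(αs)`. [cite: PineauVicol2026, (1.7) and Remark 1.3 (arXiv:2607.09619 p. 3)] -/
theorem rss_eq_pvAnsatz {β : ℝ} {W : ℝ → EuclideanSpace ℝ (Fin 3) → EuclideanSpace ℝ (Fin 3)}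
    (hrss : ∀ μ : ℝ, 0 < μ → IsRotatedDSS μ (rotZLIE (β * Real.log μ)) W) {t : ℝ} (ht : t < 0)
    (x : EuclideanSpace ℝ (Fin 3)) : W t x = pvAnsatz (-β / 2) (fun y _ => W (-1) y) t x := by
  have hnt : 0 < -t := neg_pos.2 ht
  have hsq : 0 < Real.sqrt (-t) := Real.sqrt_pos.2 hnt
  set μ : ℝ := (Real.sqrt (-t))⁻¹ with hμ_def
  have hμ : 0 < μ := inv_pos.2 hsq
  have hμ2 : μ ^ 2 * t = -1 := by
    rw [hμ_def, inv_pow, Real.sq_sqrt hnt.le, inv_mul_eq_div, div_neg, div_self ht.ne]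
  have hθ : β * Real.log μ = -(-β / 2 * -Real.log (-t)) := by
    rw [hμ_def, Real.log_inv, Real.log_sqrt hnt.le]
    ring
  -- `rotZ θ` commutes with scalars (it is the linear isometry `rotZLIE θ`)
  have hzs : ∀ (θ a : ℝ) (z : EuclideanSpace ℝ (Fin 3)), a • rotZ θ z = rotZ θ (a • z) := fun θ a z => by
    rw [← rotZLIE_apply, ← rotZLIE_apply, map_smul]
  have key := hrss μ hμ t x
  simp only [rotZLIE_symm_apply, rotZLIE_apply, hμ2, hθ, neg_neg, hzs] at key
  rw [← key]
  simp only [pvAnsatz, ← hμ_def, hzs]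

/-- **A rotated self-similar Oseen-gauge field with vanishing `t = −1` slice vanishes on the whole past.**
Immediate from the dictionary `rss_eq_pvAnsatz`: the ansatz of the zero profile is zero. -/
theorem rss_eq_zero_of_slice {β : ℝ} {W : ℝ → EuclideanSpace ℝ (Fin 3) → EuclideanSpace ℝ (Fin 3)}
    (hrss : ∀ μ : ℝ, 0 < μ → IsRotatedDSS μ (rotZLIE (β * Real.log μ)) W) (h0 : W (-1) = 0) {t : ℝ}
    (ht : t < 0) (x : EuclideanSpace ℝ (Fin 3)) : W t x = 0 := by
  rw [rss_eq_pvAnsatz hrss ht x]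
  simp only [pvAnsatz, h0, Pi.zero_apply, map_zero (rotZLIE _), ← rotZLIE_apply, smul_zero]

/-! ### Pineau–Vicol's Theorem 1.4 in the Oseen gauge -/

/-- **Tool stub F6 `stub_rssWindow` — Pineau–Vicol 2026 Thm 1.4 in the Oseen gauge (registered signature).** For
every Type-I level `C₀ > 0` there are speeds `0 < α₁, α₂` (those of `pineauVicol2026_rss_liouville_holds`) such that
every NONTRIVIAL Oseen-gauge Type-I field `W` (`IsTypeIAncientMild C₀ W`, `HasTypeIDecay C₀ W`, `W(−1) ≠ 0`) which is
rotated self-similar about `e₃` with angle rate `β` (`IsRotatedDSS μ (rotZLIE (β log μ)) W` for all `μ > 0`) has speed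
`|α| = |β|/2 ∈ [α₁, α₂]`.  Proof: by the dictionary `rss_eq_pvAnsatz`, `W = pvAnsatz (−β/2) (W(−1))` on the past;
`W` is a classical solution on `(−∞, 0)` for one smooth pressure
(`exists_isClassicalNSSolutionOn_Iio_of_isTypeIAncientMild`), hence on `[−1, 0)`; its slice `W(−1)` is `C^∞`; the
Type-I bound (1.10) is `HasTypeIDecay`; so if `|β|/2 < α₁` or `α₂ < |β|/2` Theorem 1.4 gives `W(−1) = 0`. [cite: PineauVicol2026, Theorem 1.4 (arXiv:2607.09619 p. 4)] -/
theorem stub_rssWindow :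
    ∀ C₀ : ℝ, 0 < C₀ → ∃ α₁ α₂ : ℝ, 0 < α₁ ∧ 0 < α₂ ∧
      ∀ (β : ℝ) (W : ℝ → EuclideanSpace ℝ (Fin 3) → EuclideanSpace ℝ (Fin 3)),
        Literature.Analysis.FluidPDE.IsTypeIAncientMild C₀ W → Literature.Analysis.FluidPDE.HasTypeIDecay C₀ W →
        (∀ μ : ℝ, 0 < μ → Literature.Analysis.FluidPDE.IsRotatedDSS μ (Literature.Analysis.FluidPDE.rotZLIE (β * Real.log μ)) W) →
        (∃ x, W (-1) x ≠ 0) → α₁ ≤ |β| / 2 ∧ |β| / 2 ≤ α₂ := by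
  intro C₀ hC₀
  obtain ⟨α₁, α₂, hα₁, hα₂, hPV⟩ := pineauVicol2026_rss_liouville_holds C₀ hC₀
  refine ⟨α₁, α₂, hα₁, hα₂, fun β W hW hdec hrss hnt => ?_⟩
  by_contra hcon
  obtain ⟨x₀, hx₀⟩ := hnt
  -- the excluded speeds, for `α = −β/2`
  have hout : |(-β / 2)| < α₁ ∨ α₂ < |(-β / 2)| := by
    have habs : |(-β / 2)| = |β| / 2 := by rw [abs_div, abs_neg, abs_two]
    rw [habs]
    rcases not_and_or.1 hcon with h | h
    · exact Or.inl (not_le.1 h)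
    · exact Or.inr (not_le.1 h)
  -- a classical pressure on `(−∞, 0)`, restricted to `[−1, 0)`
  obtain ⟨q, hcl⟩ := exists_isClassicalNSSolutionOn_Iio_of_isTypeIAncientMild hW
  have hcl' : IsClassicalNSSolutionOn (Ico (-1 : ℝ) 0) 1 0 W q :=
    hcl.mono Ico_subset_Iio_self (uniqueDiffOn_Ico (-1) 0)
  -- the Type-I bound (1.10) on `[−1, 0)`
  have hI : ∀ t ∈ Ico (-1 : ℝ) 0, ∀ x : EuclideanSpace ℝ (Fin 3), ‖W t x‖ ≤ C₀ / (‖x‖ + Real.sqrt (-t)) :=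
    fun t ht x => hdec t ht.2 x
  -- the profile `U = W(−1)` is `C²`
  have hU2 : ContDiff ℝ 2 (W (-1)) :=
    (hW.contDiff_slice (show (-1 : ℝ) < 0 by norm_num)).of_le (by norm_cast)
  -- the ansatz on `[−1, 0)`
  have hans : ∀ t ∈ Ico (-1 : ℝ) 0, ∀ x : EuclideanSpace ℝ (Fin 3),
      W t x = pvAnsatz (-β / 2) (fun y _ => W (-1) y) t x :=
    fun t ht x => rss_eq_pvAnsatz hrss ht.2 x
  -- Theorem 1.4
  have hU0 : W (-1) = 0 := hPV (-β / 2) W q (W (-1)) hcl' hI hU2 hans hout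
  exact hx₀ (congr_fun hU0 x₀)

/-- **The speed window, with nontriviality at any negative time.** For every `C₀ > 0` there are `0 < α₁, α₂` such
that every Oseen-gauge Type-I field `W` (`IsTypeIAncientMild C₀ W`, `HasTypeIDecay C₀ W`) which is rotated
self-similar about `e₃` with angle rate `β` and does not vanish identically on the past has `α₁ ≤ |β|/2 ≤ α₂`
(`stub_rssWindow`, the slice `W(−1)` being nonzero by `rss_eq_zero_of_slice`). [cite: PineauVicol2026, Theorem 1.4 (arXiv:2607.09619 p. 4)] -/
theorem rss_speed_mem_window :
    ∀ C₀ : ℝ, 0 < C₀ → ∃ α₁ α₂ : ℝ, 0 < α₁ ∧ 0 < α₂ ∧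
      ∀ (β : ℝ) (W : ℝ → EuclideanSpace ℝ (Fin 3) → EuclideanSpace ℝ (Fin 3)),
        IsTypeIAncientMild C₀ W → HasTypeIDecay C₀ W →
        (∀ μ : ℝ, 0 < μ → IsRotatedDSS μ (rotZLIE (β * Real.log μ)) W) →
        (∃ t < 0, ∃ x, W t x ≠ 0) → α₁ ≤ |β| / 2 ∧ |β| / 2 ≤ α₂ := by
  intro C₀ hC₀
  obtain ⟨α₁, α₂, hα₁, hα₂, hwin⟩ := stub_rssWindow C₀ hC₀
  refine ⟨α₁, α₂, hα₁, hα₂, fun β W hW hdec hrss hnt => hwin β W hW hdec hrss ?_⟩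
  by_contra hall
  push Not at hall
  obtain ⟨t, ht, x, hx⟩ := hnt
  exact hx (rss_eq_zero_of_slice hrss (funext hall) ht x)

/-- **A nontrivial rotated self-similar Oseen-gauge Type-I field has nonzero angle rate** (the case `β = 0` is a
Type-I backward self-similar field, excluded by the small-speed half of Pineau–Vicol's Theorem 1.4 — equivalently
by Tsai 1998 / Chae–Wolf 2017). [cite: PineauVicol2026, Theorem 1.4 (arXiv:2607.09619 p. 4)] -/
theorem rss_angleRate_ne_zero {C₀ β : ℝ} {W : ℝ → EuclideanSpace ℝ (Fin 3) → EuclideanSpace ℝ (Fin 3)}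
    (hC₀ : 0 < C₀) (hW : IsTypeIAncientMild C₀ W) (hdec : HasTypeIDecay C₀ W)
    (hrss : ∀ μ : ℝ, 0 < μ → IsRotatedDSS μ (rotZLIE (β * Real.log μ)) W) (hnt : ∃ t < 0, ∃ x, W t x ≠ 0) :
    β ≠ 0 := by
  obtain ⟨α₁, α₂, hα₁, -, hwin⟩ := rss_speed_mem_window C₀ hC₀
  have h := (hwin β W hW hdec hrss hnt).1
  intro hβ
  rw [hβ, abs_zero, zero_div] at h
  exact absurd h (not_le.2 hα₁)

end Summit.NavierStokesRegularity.NavierStokesRegularity.Theorems.CorkscrewProfile.Birth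

end
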